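import Summits.HodgeConjecture.HodgeConjecture.Theses.TorelliForSymmetries
import Literature.AlgebraicGeometry.Motives.SegreEmbedding

/-!
# Costume certificate for the crux `MiddleInvolutions` (stmt-HodgeConjecture-14418)

Crux-strategist r1 (redirect scan, 2026-08-17). Two kernel-checked facts:

* `middleInvolutions_of_hodgeConjecture : HodgeConjecture → MiddleInvolutions` — **S → C**, for EVERY
  guarded Betti–Hodge datum (re-derivation of the refuter's certificate of 2026-08-16, whose file is
  not visible from this seat). Involutivity `φ ∘ φ = id` is NOT used: the Künneth–Hodge clause turns
  any `B`-Hodge endomorphism of `H^{2n}_B(Y)` into a middle Hodge class on the square `Y × Y`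
  (smooth projective of dimension `(n+n)+(n+n)`, `IsSmoothProjective.tensor_holds`), the summit HC
  for `Y × Y` transfers to `B.HodgeConjectureFor` by comparison-compatibility
  (`IsComparisonCompatible.bettiHodgeConjectureFor`), and `ℚ·A ⊆ A ⊗ ℚ`.
* `hodgeConjecture_of_middleInvolutions` — **C → S** modulo exactly the route's four SUPPORT items
  (`ClassicalBettiDatum` = the classical comparison package, `ReflectionsDecide` = the reflection
  lemma, `InvolutionsOfMiddle`, `Assembly` — the last three `provable-now` by the route's own
  account): this is the route's `closes` with its four unused binders dropped.

Hence `middleInvolutions_iff_hodgeConjecture`: given the four supports, `MiddleInvolutions ↔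
HodgeConjecture`. The crux is the summit read through the dictionary
`v ↦ s_v` (Hodge class ↦ reflection), `φ ↦ graph φ` (endomorphism ↦ middle Hodge class on the square).
-/

namespace Summit.HodgeConjecture.HodgeConjecture.Cruxes.MiddleInvolutions.Costume

open Literature.AlgebraicGeometry.Motives CategoryTheory MonoidalCategory
open Summit.HodgeConjecture.HodgeConjecture.Theses.TorelliForSymmetries

/-- `ℚ · Aᵖ(X) ⊆ Aᵖ(X) ⊗ ℚ` for a Weil cohomology with `ℚ`-coefficients (same lemma as in the
registered birth skeleton; reproduced so that this certificate imports no `sorry`).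
[cite: Kleiman1968, §1.4] -/
theorem mem_ratAlgebraicClasses_of_mem_algebraicClasses {k : Type*} [Field k]
    (W : WeilCohomology k ℚ) (X : SchemeOver k) (p : ℕ) {x : W.obj X (2 * p)}
    (hx : x ∈ W.algebraicClasses X p) : x ∈ W.ratAlgebraicClasses X p := by
  change x ∈ Submodule.span ℚ (W.algebraicLattice X p : Set (W.obj X (2 * p))) at hx
  induction hx using Submodule.span_induction with
  | mem y hy => exact W.algebraicLattice_le_ratAlgebraicClasses X p hy
  | zero => exact zero_mem _
  | add y z _ _ hy hz => exact add_mem hy hz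
  | smul q y _ hy =>
    obtain ⟨N, hN, hNy⟩ := hy
    refine ⟨N * q.den, mul_ne_zero hN (by exact_mod_cast q.den_ne_zero), ?_⟩
    have h : (N * (q.den : ℤ)) • (q • y) = q.num • (N • y) := by
      rw [← Int.cast_smul_eq_zsmul ℚ (N * (q.den : ℤ)) (q • y), ← Int.cast_smul_eq_zsmul ℚ N y,
        ← Int.cast_smul_eq_zsmul ℚ q.num _, smul_smul, smul_smul]
      congr 1
      push_cast
      rw [mul_assoc, Rat.den_mul_eq_num]
      ring
    rw [h]
    exact AddSubgroup.zsmul_mem _ hNy _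

/-- **S → C.** The summit statement implies the crux `MiddleInvolutions` for every guarded
Betti–Hodge datum; involutivity is unused. [cite: VoisinHodgeI2002, Lemma 11.41 and §11.3.3] -/
theorem middleInvolutions_of_hodgeConjecture : _root_.HodgeConjecture → MiddleInvolutions := by
  intro hHC
  unfold Summit.HodgeConjecture.HodgeConjecture.Theses.TorelliForSymmetries.MiddleInvolutions
  intro B hB K n Y hY φ _hφ j' hj
  -- the square is smooth projective of dimension (n+n)+(n+n)
  have hYY : IsSmoothProjective ((n + n) + (n + n)) (Y ⊗ Y) :=
    IsSmoothProjective.tensor_holds hY hY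
  -- Künneth–Hodge clause at X := Y, i := 2n: a middle Hodge class on Y × Y inducing φ
  obtain ⟨u, hu, hind⟩ := K hY hYY (2 * n) j' hj φ
  -- summit HC for Y × Y, transferred to the B-relative statement in codimension n + n
  have hHC' : B.HodgeConjectureFor hYY (n + n) :=
    hB.bettiHodgeConjectureFor hYY (hHC hYY) (n + n)
  have hu' : u ∈ B.W.algebraicClasses (Y ⊗ Y) (n + n) :=
    (B.hodgeConjectureFor_iff hYY (n + n)).1 hHC' hu
  exact ⟨u, mem_ratAlgebraicClasses_of_mem_algebraicClasses B.W (Y ⊗ Y) (n + n) hu', hind⟩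

/-- **C → S modulo the route's four support items** (the route's `closes` with its unused binders
`InvolutionsAreCorrespondences`, `HypersurfaceInvolutions`, `CyclicGenericCommutant`,
`SurfaceInvolutions` dropped). -/
theorem hodgeConjecture_of_middleInvolutions (hDatum : ClassicalBettiDatum)
    (hRefl : ReflectionsDecide) (hGlue : InvolutionsOfMiddle) (hAsm : Assembly) :
    MiddleInvolutions → _root_.HodgeConjecture :=
  fun hM => hAsm hDatum (hGlue hRefl hM)

/-- **The costume theorem.** Given the four support items (classical comparison package +
three elementary lemmas), the crux `MiddleInvolutions` is EQUIVALENT to the summit statement. -/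
theorem middleInvolutions_iff_hodgeConjecture (hDatum : ClassicalBettiDatum)
    (hRefl : ReflectionsDecide) (hGlue : InvolutionsOfMiddle) (hAsm : Assembly) :
    MiddleInvolutions ↔ _root_.HodgeConjecture :=
  ⟨hodgeConjecture_of_middleInvolutions hDatum hRefl hGlue hAsm, middleInvolutions_of_hodgeConjecture⟩

/-- Same, with the route's `closes` consumed literally (its nine binders in route order). -/
theorem hodgeConjecture_of_middleInvolutions' (hDatum : ClassicalBettiDatum)
    (hRefl : ReflectionsDecide) (hGlue : InvolutionsOfMiddle) (hAsm : Assembly)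
    (h0 : InvolutionsAreCorrespondences) (h2 : HypersurfaceInvolutions)
    (h3 : CyclicGenericCommutant) (h4 : SurfaceInvolutions) :
    MiddleInvolutions → _root_.HodgeConjecture :=
  fun hM => closes h0 hAsm h2 h3 h4 hM hDatum hRefl hGlue

end Summit.HodgeConjecture.HodgeConjecture.Cruxes.MiddleInvolutions.Costume
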